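import Summits.BirchSwinnertonDyer.BirchSwinnertonDyer.Theses.CyclotomicUntwist
import Summits.BirchSwinnertonDyer.BirchSwinnertonDyer.Theorems.CyclotomicUntwistFiniteSlopeSeparatedPinnedLogNormOneSidedSigmaLine
import Summits.BirchSwinnertonDyer.BirchSwinnertonDyer.Theorems.CyclotomicUntwistLineCoefficients
import Summits.BirchSwinnertonDyer.BirchSwinnertonDyer.Theorems.CyclotomicUntwistPSUntwistedTraceDefs
import Summits.BirchSwinnertonDyer.BirchSwinnertonDyer.Theorems.CyclotomicUntwistDescendedFrobeniusEigenconstantCoeffs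
import Literature.NumberTheory.EllipticCurves.DescendedFrobeniusMatrix
import HarnessLib

/-!
# K-SEP glue of route `CyclotomicUntwist`, K2 family: `C5≤ → Shared → PSRankOneUpperHalfAtThree`
# (glue item stmt-BirchSwinnertonDyer-27594 `PSUpperHalfOfDFrobKatoChildren`; closer-of for the bookkeeping
# conjunction stmt-BirchSwinnertonDyer-27593 `PSDFrobSharedChildrenAtThree`)

Cell `pub/bsd-wall`, pen bsd-wall-pss3x g5 — TURNKEY closer (`HOME/bsd-wall-pss3x/cuS/SketchK3.lean`,
`psRankOneUpperHalfAtThree_of_dfrobKatoChildren`), landed by seat bsd-line-cycu-p5 g9 as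
`Theorems/CyclotomicUntwistKSepGlueK2.lean --workitem stmt-BirchSwinnertonDyer-27594`. The K2 split (route rev 6)
filed the registered ONE-SIDED line `dfrob_kato` of lead bsd-line-cycu-p1 g5 (`Cruxes/PSRankOneUpperHalfAtThree/Lines/dfrob_kato.lean`)
as the children C5≤ = `PSpAdicBSDKatoSideDescendedEigenlineAtThree` (27592, N-pBSD₃′ at the descended eigenline,
KATO direction only) and Shared = `PSDFrobSharedChildrenAtThree` (27593) := C4 ∧ C1 ∧ C2 of K1's family
(`PSGrossZagierDescendedEigenlineAtThree` 27546, `PSUntwistedLFunctionAtThree` 27548,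
`PSDescendedFrobeniusPrintedInputsAtThree` 27549). The proof is the skeleton's sorry-free composition with the stubs
replaced by the children, through the one-sided normed σ-line closer
`psRankOneUpperHalfAtThree_of_separated_pin_intrinsic_sigmaLine_log_norm_le` (p628075) and the landed S3
`eigenconstant_coeffs` (p625113); the descended-Frobenius numbers `(a, b)` are chosen per curve exactly as in the
K1 glue `CyclotomicUntwistKSepGlue` (p-landed, item 27550). THEOREMS ONLY; BSD is not proved here and no child is:
C5≤, C4, C1 are research-sized HYPOTHESES and C2 carries the published input GZK.
-/

set_option linter.dupNamespace false
noncomputable section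

open scoped Classical MatrixGroups
open CongruenceSubgroup WeierstrassCurve WeierstrassCurve.Affine.Point Literature.NumberTheory.EllipticCurves
  Literature.NumberTheory.EllipticCurves.ModularForms Literature.NumberTheory.EllipticCurves.Rank1Residual
  Literature.NumberTheory.IwasawaTheory Summit.BirchSwinnertonDyer.Rank1Residual.Additive
  Summit.BirchSwinnertonDyer.BirchSwinnertonDyer.Theses.CyclotomicUntwist
  Summit.BirchSwinnertonDyer.BirchSwinnertonDyer.Theorems.CyclotomicUntwistFiniteSlopeSeparatedPinnedLogNormOneSidedSigmaLine
  Summit.BirchSwinnertonDyer.BirchSwinnertonDyer.Theorems.PSLineCoefficients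
  IsCyclotomicExtension

namespace Summit.BirchSwinnertonDyer.BirchSwinnertonDyer.Theorems.CyclotomicUntwistKSepGlueK2

/-- K2 `PSRankOneUpperHalfAtThree` from the Kato-side child C5≤ and the three children C4, C1, C2 it shares with
K1's family (composition of the registered one-sided line `dfrob_kato`, stubs ↦ hypotheses). -/
theorem psRankOneUpperHalfAtThree_of_kato_core
    (h4 : PSGrossZagierDescendedEigenlineAtThree) (h5 : PSpAdicBSDKatoSideDescendedEigenlineAtThree)
    (h1 : PSUntwistedLFunctionAtThree) (h2 : PSDescendedFrobeniusPrintedInputsAtThree) :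
    PSRankOneUpperHalfAtThree := by
  -- the coefficient package
  obtain ⟨ψ, σ, hψ2, hψ3, hψ1, hσ⟩ := exists_line_and_conjugation
  obtain ⟨ι, hι⟩ := exists_algHom_padicComplex_injective
  -- the eigenline dictionary as a predicate on pairs `(a, b)`
  let Good : (W : WeierstrassCurve ℚ) → ℂ_[3] → ℚ_[3] × ℚ_[3] → Prop := fun W α ab =>
    ab.2 ≠ 0 ∧ ∀ M : Matrix (Fin 2) (Fin 2) ℚ_[3], W.IsDescendedFrobeniusMatrix M →
      (algebraMap ℚ_[3] ℂ_[3] ab.1 + algebraMap ℚ_[3] ℂ_[3] ab.2 * ι (ψ 2)) * algebraMap ℚ_[3] ℂ_[3] (M 1 0) =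
        algebraMap ℚ_[3] ℂ_[3] (M 0 0) + (α - algebraMap ℚ_[3] ℂ_[3] M.trace)
  -- the D5 numbers by choice (junk `(0, 1)` off the locus where the dictionary applies)
  let ab : (W : WeierstrassCurve ℚ) → DirichletCharacter ℂ_[3] (3 ^ 2) → ℂ_[3] → ℚ_[3] × ℚ_[3] :=
    fun W _ α => if h : ∃ p : ℚ_[3] × ℚ_[3], Good W α p then h.choose else (0, 1)
  have hb : ∀ W η α, (ab W η α).2 ≠ 0 := by
    intro W η α
    show (if h : ∃ p : ℚ_[3] × ℚ_[3], Good W α p then h.choose else ((0 : ℚ_[3]), (1 : ℚ_[3]))).2 ≠ 0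
    split_ifs with h
    · exact h.choose_spec.1
    · exact one_ne_zero
  have hgood : ∀ W η α, (∃ p : ℚ_[3] × ℚ_[3], Good W α p) → Good W α (ab W η α) := by
    intro W η α h
    show Good W α (if h : ∃ p : ℚ_[3] × ℚ_[3], Good W α p then h.choose else ((0 : ℚ_[3]), (1 : ℚ_[3])))
    rw [dif_pos h]
    exact h.choose_spec
  -- on a principal-series row the dictionary applies at the admissible root `α`
  have hrow : ∀ (W : WeierstrassCurve ℚ) [W.IsElliptic] [W.IsGloballyMinimal],
      Summit.BirchSwinnertonDyer.Rank1Residual.Additive.ClassO6 W 3 →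
      Even (padicValInt 3 W.minimalDiscriminantInt) →
      W.minimalDiscriminantInt / 3 ^ padicValInt 3 W.minimalDiscriminantInt % 3 = 1 →
      ∀ (η : DirichletCharacter ℂ_[3] (3 ^ 2)) (α : ℂ_[3]),
        α ^ 2 - ((W.psUntwistedTrace : ℤ) : ℂ_[3]) * α + 3 = 0 →
        ∃ M : Matrix (Fin 2) (Fin 2) ℚ_[3], W.IsDescendedFrobeniusMatrix M ∧ Good W α (ab W η α) := by
    intro W _ _ hO6 hev hsq η α hroot
    obtain ⟨M, hM, htr, hγ⟩ := h2.2 W hO6 hev hsq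
    have htr' : M.trace = 0 ∨ M.trace = 3 ∨ M.trace = -3 := by
      rcases Summit.BirchSwinnertonDyer.BirchSwinnertonDyer.Theorems.PSUntwistedTrace.psUntwistedTrace_eq_or W
        with h | h | h
      · exact Or.inl (by rw [htr, h]; push_cast; rfl)
      · exact Or.inr (Or.inl (by rw [htr, h]; push_cast; rfl))
      · exact Or.inr (Or.inr (by rw [htr, h]; push_cast; rfl))
    have hroot' : α ^ 2 - algebraMap ℚ_[3] ℂ_[3] M.trace * α + 3 = 0 := by
      rw [htr, map_intCast]; exact hroot
    obtain ⟨a, b, hb0, hdict⟩ :=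
      Summit.BirchSwinnertonDyer.BirchSwinnertonDyer.Theorems.PSDescendedFrobeniusEigenconstantCoeffs.eigenconstant_coeffs
        ψ ι hψ2 hι M α hM.det_eq htr' hγ hroot'
    refine ⟨M, hM, hgood W η α ⟨(a, b), hb0, fun M' hM' => ?_⟩⟩
    rw [hM'.unique hM]
    exact hdict
  -- the one-sided (Kato) closer of record
  have H := psRankOneUpperHalfAtThree_of_separated_pin_intrinsic_sigmaLine_log_norm_le (R := CyclotomicField 3 ℚ_[3])
    ι hι ψ σ hσ ⟨hψ3, hψ1⟩ (fun _ _ _ => (0 : ℚ_[3])) (fun W η α => (ab W η α).1) (fun W η α => (ab W η α).2)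
    (fun _ _ _ => by rw [norm_zero]; exact zero_le_one) hb
    (fun W η α Dh => ∀ χ : DirichletCharacter (CyclotomicField 3 ℚ_[3]) 9, (χ = ψ ∨ χ = ψ⁻¹) →
      ∀ {x y : ℚ} (hxy : W.toAffine.Nonsingular x y),
        1 < ‖(x : ℚ_[3])‖ → ‖(-(x : ℚ_[3]) / (y : ℚ_[3]))‖ ≤ ((3 : ℝ)⁻¹) ^ 3 →
          (∀ ℓ : ℕ, ℓ.Prime → W.HasNonsingularReductionAt ℓ x y) →
            Dh.pairing χ (.some x y hxy) (.some x y hxy) =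
              algebraMap ℚ_[3] (CyclotomicField 3 ℚ_[3]) (CensusX42.sigmaHeight W 3
                  ((W.baseChange ℚ_[3]).formalSigma 0) (.some x y hxy)) +
                (algebraMap ℚ_[3] (CyclotomicField 3 ℚ_[3]) (ab W η α).1 +
                    algebraMap ℚ_[3] (CyclotomicField 3 ℚ_[3]) (ab W η α).2 * χ 2) *
                  algebraMap ℚ_[3] (CyclotomicField 3 ℚ_[3])
                    (padicEval (W.baseChange ℚ_[3]).formalLog (-(x : ℚ_[3]) / (y : ℚ_[3]))) ^ 2)
    (fun W _ _ η α Dh => by simp only [_root_.map_zero, sub_zero])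
    (fun W => W.psUntwistedTrace) h2.1 h1 ?_ ?_
  · exact H
  · -- N-GZ₃′ from C4 at THE matrix and the chosen numbers
    intro W _ _ hCM hO6 hsurj hev hsq hr η α 𝓛 ϖ hη hroot hμ hϖ Dh hDh P hP q hL
    obtain ⟨M, hM, hb0, hdict⟩ := hrow W hO6 hev hsq η α hroot
    exact h4 ψ ι hψ2 hι W hCM hO6 hsurj hev hsq hr η α 𝓛 ϖ hη hroot hμ hϖ M hM
      (ab W η α).1 (ab W η α).2 hb0 (hdict M hM) Dh hDh P hP q hL
  · -- N-pBSD₃′^{≤} (Kato direction) from C5≤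
    intro W _ _ hCM hO6 hsurj hev hsq hr η α 𝓛 ϖ hη hroot hμ hϖ Dh hDh P hP
    obtain ⟨M, hM, hb0, hdict⟩ := hrow W hO6 hev hsq η α hroot
    exact h5 ψ ι hψ2 hι W hCM hO6 hsurj hev hsq hr η α 𝓛 ϖ hη hroot hμ hϖ M hM
      (ab W η α).1 (ab W η α).2 hb0 (hdict M hM) Dh hDh P hP

/-- CLOSER of the glue item stmt-BirchSwinnertonDyer-27594
`PSUpperHalfOfDFrobKatoChildren : C5≤ → Shared → PSRankOneUpperHalfAtThree`. -/
theorem psUpperHalfOfDFrobKatoChildren_proof : PSUpperHalfOfDFrobKatoChildren :=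
  fun h5 hS => psRankOneUpperHalfAtThree_of_kato_core hS.1 h5 hS.2.1 hS.2.2

/-- Closer-of for the bookkeeping conjunction stmt-BirchSwinnertonDyer-27593 `PSDFrobSharedChildrenAtThree`:
it holds the moment C4 (27546), C1 (27548) and C2 (27549) are theorems (And.intro; no mathematics). -/
theorem psDFrobSharedChildrenAtThree_of (h4 : PSGrossZagierDescendedEigenlineAtThree)
    (h1 : PSUntwistedLFunctionAtThree) (h2 : PSDescendedFrobeniusPrintedInputsAtThree) :
    PSDFrobSharedChildrenAtThree :=
  ⟨h4, h1, h2⟩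

/-- K2 directly from the four statements C4, C5≤, C1, C2 (the glue and the conjunction composed). -/
theorem psRankOneUpperHalfAtThree_of_dfrobKatoChildren
    (h4 : PSGrossZagierDescendedEigenlineAtThree) (h5 : PSpAdicBSDKatoSideDescendedEigenlineAtThree)
    (h1 : PSUntwistedLFunctionAtThree) (h2 : PSDescendedFrobeniusPrintedInputsAtThree) :
    PSRankOneUpperHalfAtThree :=
  psUpperHalfOfDFrobKatoChildren_proof h5 (psDFrobSharedChildrenAtThree_of h4 h1 h2)

end Summit.BirchSwinnertonDyer.BirchSwinnertonDyer.Theorems.CyclotomicUntwistKSepGlueK2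
end
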